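import Summits.Ventures.CertifiedManyBodySolver.Theorems.M3x2EdgeSplitSymReplayOutRoute

/-! # (crux workfile copy, namespace `.E5` to stay clear of a future Theorems landing) E0-Z «CLOSED-FORM MOVE» drop-in for the box canon OF RECORD (pen hub-lb-sym-plan-1 g4; scratch, NOT a proposal — registry frozen O3/O4).
Measured (e5/E5BenchR, e5/MoveZ): the tree verified step `nfWord ∘ moveWordV` costs 102 µs/image of which the MOVE is 82 µs (`d4R` = iterated
`![−v 1, v 0]` closures read back through `Fin.cons`); the closed-form twin `moveWordZ` (integer pairs, `rotZ` structural like `d4R`'s iterate, ONE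
`mkSite` per letter) is PROVED equal (`moveWordZ_eq`) and costs 22 µs.  The box canon of record `canonTermAB` performs TWO moves per image × 8
images per word (1 586 µs/word measured); this file is its drop-in twin with both moves closed-form — `anchoredNFsBZ`/`canonABZ`/`canonTermABZ`/
`canonNFZBZ`/`shardOKRGBZ` — each PROVED equal to the tree's (`…_eq`, unconditional, by `moveWordZ_eq`), so a fact module may evaluate
`shardOKRGBZ … = true` by `native_decide` and conclude the fact of record `shardOKRGB … = true` by one rewrite; no soundness text changes.
MEASURED (pub hub-lb-sym-plan-1/e5/BoxCanonZ.lean bench, 1 912 synthetic normal 6-letter words, interpreted = the `native_decide` evaluator):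
`canonTermAB` 3 074 ms vs `canonTermABZ` 1 227 ms (÷2.5; 1 608 → 642 µs/word), 0/1 912 disagreements.  LANDING SHAPE (engine item, after crit-1's
word): this text as `Theorems/M3x2EdgeSplitSymReplayBoxCanonZ.lean` (+ cell docstring grammar, `import HarnessLib`); E-class fact modules then prove
`shardOKRGB … = true` by `rw [← shardOKRGBZ_eq]; native_decide` (the evaluated term is the Z twin), Cert.lean unchanged.  No summit statement is proved here. -/

open Literature.MathematicalPhysics.QuantumLattice
open Literature.MathematicalPhysics.QuantumLattice.HubbardWave0
open Literature.Probability.LatticeModels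
open Summit.Ventures.CertifiedManyBodySolver.Theorems.SymReplay

namespace Summit.Ventures.CertifiedManyBodySolver.Theorems.SymReplay.E5

/-- `rotᵏ` on integer pairs (`rot (a,b) = (−b,a)`), structural on `k` exactly like `d4R`'s iterate. -/
def rotZ : ℕ → ℤ × ℤ → ℤ × ℤ
  | 0, p => p
  | k + 1, p => rotZ k (-p.2, p.1)

/-- The eight point-group maps on integer pairs (`r i ↦ rotⁱ`, `sr i ↦ refl ∘ rotⁱ`, `refl (a,b) = (a,−b)`). -/
def d4Z : DihedralGroup 4 → ℤ → ℤ → ℤ × ℤ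
  | .r i, a, b => rotZ i.val (a, b)
  | .sr i, a, b => let p := rotZ i.val (a, b); (p.1, -p.2)

/-- Closed-form move of a word (`= moveWordV`, `moveWordZ_eq`). -/
def moveWordZ (γ : DihedralGroup 4) (v : Site 2) (w : Word) : Word :=
  let v0 := v 0; let v1 := v 1
  w.map fun ℓ => let p := d4Z γ (ℓ.x 0) (ℓ.x 1); ⟨mkSite (p.1 + v0) (p.2 + v1), ℓ.s, ℓ.dag⟩

theorem rotZ_spec : ∀ (k : ℕ) (x : Site 2),
    rotZ k (x 0, x 1) = (((fun v : Site 2 => (![-v 1, v 0] : Site 2))^[k] x) 0, ((fun v : Site 2 => (![-v 1, v 0] : Site 2))^[k] x) 1)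
  | 0, x => by simp [rotZ]
  | k + 1, x => by
    rw [rotZ, Function.iterate_succ_apply, ← rotZ_spec k]
    simp

theorem d4Z_spec (γ : DihedralGroup 4) (x : Site 2) : d4Z γ (x 0) (x 1) = (d4R γ x 0, d4R γ x 1) := by
  rcases γ with i | i
  · simp only [d4Z, d4R, rotZ_spec]
  · simp only [d4Z, d4R, rotZ_spec]
    simp

theorem moveWordZ_eq (γ : DihedralGroup 4) (v : Site 2) (w : Word) : moveWordZ γ v w = moveWordV γ v w := by
  unfold moveWordZ moveWordV
  refine List.map_congr_left fun ℓ _ => ?_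
  simp only [d4Z_spec, moveSite, Pi.add_apply]

theorem moveWordZ_eq' : moveWordZ = moveWordV := by
  funext γ v w; exact moveWordZ_eq γ v w

/-! ## The box canon of record with closed-form moves (verbatim twins of `…BoxCanon` §anchoredNFsB … shardOKRGB) -/

def anchoredNFsBZ (lo hi : ℤ × ℤ) (u : Word) : List QPoly :=
  d4All.filterMap fun γ =>
    let m := minCornerP (wordSites (moveWordZ γ 0 u))
    let a := lo.1 - m.1
    let b := lo.2 - m.2
    let w := moveWordZ γ (mkSite a b) u
    if inBox lo hi w then some (nfWord w) else none

def canonABZ (lo hi : ℤ × ℤ) (u : Word) : QPoly :=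
  match anchoredNFsBZ lo hi u with
  | [] => [(1, u)]
  | c :: cs =>
    let best := cs.foldl (fun b c' => if polyKeyLt c' b then c' else b) c
    if (c :: cs).any (polyNegEq best) then [] else best

def canonTermABZ (lo hi : ℤ × ℤ) (t : ℚ × Word) : QPoly := pscale t.1 (canonABZ lo hi t.2)

def canonNFZBZ (lo hi : ℤ × ℤ) (p : QPoly) : QPoly :=
  (dropZeros (collect (nfPoly p))).flatMap (canonTermABZ lo hi)

def shardOKRGBZ (K : SymCertR) (c : ℕ) (sizes : List ℕ) (lo hi : ℤ × ℤ) (j : ℕ) (P : QPoly) : Bool :=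
  psuppInB lo hi P && isZero (psub (canonNFZBZ lo hi (shardPolyAtRGFast K c sizes j)) P)

theorem anchoredNFsBZ_eq : anchoredNFsBZ = anchoredNFsB := by
  funext lo hi u; simp only [anchoredNFsBZ, anchoredNFsB, moveWordZ_eq']

theorem canonABZ_eq : canonABZ = canonAB := by
  funext lo hi u
  unfold canonABZ canonAB
  rw [anchoredNFsBZ_eq]
  try rfl

theorem canonTermABZ_eq : canonTermABZ = canonTermAB := by
  funext lo hi t; simp only [canonTermABZ, canonTermAB, canonABZ_eq]

theorem canonNFZBZ_eq : canonNFZBZ = canonNFZB := by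
  funext lo hi p; simp only [canonNFZBZ, canonNFZB, canonTermABZ_eq]

/-- **Drop-in**: a fact module proves `shardOKRGBZ … = true` by `native_decide` and gets the fact of record by `rw [← shardOKRGBZ_eq]`. -/
theorem shardOKRGBZ_eq : shardOKRGBZ = shardOKRGB := by
  funext K c sizes lo hi j P; simp only [shardOKRGBZ, shardOKRGB, canonNFZBZ_eq]

end Summit.Ventures.CertifiedManyBodySolver.Theorems.SymReplay.E5
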